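import Mathlib
import HarnessLib
import Summits.QuantumFields.YangMills.Theorems.LangevinControlUVFemtoCurvatureSkewnessTreeRatioFloorHessian
import Summits.QuantumFields.YangMills.Theorems.LangevinControlUVFemtoCurvatureSkewnessTreeRatioFloorLower

/-!
# `FemtoCurvatureSkewness` — stub `stub_treeRatioFloor` of line `coupling-cubic-response` (crux stmt-QuantumFields-9365)

**Tree-level ratio floor.** For the zero-mode-free transverse torus propagator of the `(0,1)`-plaquette field,
`F(y) = ∑_{k ∈ (ℤ/L)⁴, k ≠ 0} (k̂₀²+k̂₁²)/(k̂₀²+k̂₁²+k̂₂²+k̂₃²) cos(2π(k₂y₂+k₃y₃)/L)`, `k̂ᵢ² = 2 - 2cos(2πkᵢ/L)`, there is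
an absolute `ρ₀ > 0` with `ρ₀ F(n e₂) ≤ F(n(e₃ - e₂))` for all `L` and `1 ≤ n ≤ L/8`.

Proof: `F(n e₂) ≤ C L⁴/n⁴` (`…TreeRatioFloorHessian`: `F = -(L⁴/2)(∇₀⁺∇₀⁻+∇₁⁺∇₁⁻) torusGreen` and the tree's
discrete Calderón–Zygmund estimate for the torus Green function of `Literature/Probability/LatticeModels`), and
`F(n(e₃-e₂)) ≥ c L⁴/n⁴` (`…TreeRatioFloorLower`: heat-kernel representation `2L⁴∫₀^∞ w q(·,0) q(·,n)²` with a
non-negative integrand and Fourier-side lower bounds on the window `s ≍ n²`); `ρ₀ = c/C`.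
-/

noncomputable section

namespace Summit.QuantumFields.YangMills.Theorems.FemtoCurvatureSkewness

open Finset
open scoped BigOperators

/-- **Tree-level ratio floor** (registered stub `TreeRatioFloor` of crux stmt-QuantumFields-9365, line
`coupling-cubic-response`; signature verbatim): the diagonal transverse propagator dominates a fixed multiple
of the axis one, uniformly in the torus size `L` and the separation `1 ≤ n ≤ L/8`. -/
theorem TreeRatioFloor :
    ∃ ρ₀ : ℝ, 0 < ρ₀ ∧ ∀ (L n : ℕ) [NeZero L], 1 ≤ n → 8 * n ≤ L →
      ρ₀ * (∑ k : Fin 4 → ZMod L,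
        (if k = 0 then 0 else ((2 - 2 * Real.cos (2 * Real.pi * ((k 0).val : ℝ) / L)) + (2 - 2 * Real.cos (2 * Real.pi * ((k 1).val : ℝ) / L))) /
          ((2 - 2 * Real.cos (2 * Real.pi * ((k 0).val : ℝ) / L)) + (2 - 2 * Real.cos (2 * Real.pi * ((k 1).val : ℝ) / L)) +
            (2 - 2 * Real.cos (2 * Real.pi * ((k 2).val : ℝ) / L)) + (2 - 2 * Real.cos (2 * Real.pi * ((k 3).val : ℝ) / L)))) *
          Real.cos (2 * Real.pi * ((k 2).val : ℝ) * n / L)) ≤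
      ∑ k : Fin 4 → ZMod L,
        (if k = 0 then 0 else ((2 - 2 * Real.cos (2 * Real.pi * ((k 0).val : ℝ) / L)) + (2 - 2 * Real.cos (2 * Real.pi * ((k 1).val : ℝ) / L))) /
          ((2 - 2 * Real.cos (2 * Real.pi * ((k 0).val : ℝ) / L)) + (2 - 2 * Real.cos (2 * Real.pi * ((k 1).val : ℝ) / L)) +
            (2 - 2 * Real.cos (2 * Real.pi * ((k 2).val : ℝ) / L)) + (2 - 2 * Real.cos (2 * Real.pi * ((k 3).val : ℝ) / L)))) *
          Real.cos (2 * Real.pi * (((k 3).val : ℝ) - ((k 2).val : ℝ)) * n / L) := by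
  obtain ⟨C, hC, hup⟩ := TreeRatio.axisSum_le
  obtain ⟨c, hc, hlow⟩ := CycleKernel.diagSum_ge
  refine ⟨c / C, div_pos hc hC, fun L n _ hn hnL => ?_⟩
  have h1 := hup L n hn hnL
  have h2 := hlow L n hn hnL
  calc c / C * _ ≤ c / C * (C * (L : ℝ) ^ 4 / (n : ℝ) ^ 4) := mul_le_mul_of_nonneg_left h1 (div_pos hc hC).le
    _ = c * (L : ℝ) ^ 4 / (n : ℝ) ^ 4 := by field_simp
    _ ≤ _ := h2

/-- The stub under its skeleton name. -/
theorem stub_treeRatioFloor :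
    ∃ ρ₀ : ℝ, 0 < ρ₀ ∧ ∀ (L n : ℕ) [NeZero L], 1 ≤ n → 8 * n ≤ L →
      ρ₀ * (∑ k : Fin 4 → ZMod L,
        (if k = 0 then 0 else ((2 - 2 * Real.cos (2 * Real.pi * ((k 0).val : ℝ) / L)) + (2 - 2 * Real.cos (2 * Real.pi * ((k 1).val : ℝ) / L))) /
          ((2 - 2 * Real.cos (2 * Real.pi * ((k 0).val : ℝ) / L)) + (2 - 2 * Real.cos (2 * Real.pi * ((k 1).val : ℝ) / L)) +
            (2 - 2 * Real.cos (2 * Real.pi * ((k 2).val : ℝ) / L)) + (2 - 2 * Real.cos (2 * Real.pi * ((k 3).val : ℝ) / L)))) *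
          Real.cos (2 * Real.pi * ((k 2).val : ℝ) * n / L)) ≤
      ∑ k : Fin 4 → ZMod L,
        (if k = 0 then 0 else ((2 - 2 * Real.cos (2 * Real.pi * ((k 0).val : ℝ) / L)) + (2 - 2 * Real.cos (2 * Real.pi * ((k 1).val : ℝ) / L))) /
          ((2 - 2 * Real.cos (2 * Real.pi * ((k 0).val : ℝ) / L)) + (2 - 2 * Real.cos (2 * Real.pi * ((k 1).val : ℝ) / L)) +
            (2 - 2 * Real.cos (2 * Real.pi * ((k 2).val : ℝ) / L)) + (2 - 2 * Real.cos (2 * Real.pi * ((k 3).val : ℝ) / L)))) *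
          Real.cos (2 * Real.pi * (((k 3).val : ℝ) - ((k 2).val : ℝ)) * n / L) :=
  TreeRatioFloor

end Summit.QuantumFields.YangMills.Theorems.FemtoCurvatureSkewness

end
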